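import Literature.NumberTheory.EllipticCurves.GreenbergVatsal2000.IwasawaInvariants
import Literature.NumberTheory.EllipticCurves.CyclotomicIwasawaMainTheoremIrreducible
import HarnessLib

/-!
# Burungale–Castella–Skinner 2025, Theorem 1.1.2 (b): Mazur's (MC) in `Λ` at a good ordinary prime `p > 3` under (irr_ℚ) and (im)

HONEST FRAMING (cell `b2b-bsdres`, run/shared/lean/b2b/bsd-rank1-residual/; page 1 everywhere):
the goal of the cell is to DELETE the COMBINATION-SHAPED residual classes of the BSD formula for ALL
analytic-rank `≤ 1` curves over `ℚ` from PUBLISHED theorems only, so that the remainder becomes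
exactly the CONSTRUCTION-SHAPED classes, which are TYPED, not attempted; this is not "finishing
BSD". This file vendors ONE published theorem as a named fact (`def … : Prop`, nothing asserted;
D-0014/D-0026): the INTEGRAL cyclotomic main-conjecture input of the irreducible-residual-image
row C2 of RESIDUAL-CASES §a.1 — part (b) of Burungale–Castella–Skinner's Theorem 1.1.2, the clause
named as `-- TODO(general form)` in the tree's transcription of part (a)
(`burungale_castella_skinner_charIdeal_eq_padicLFunction`, file
`CyclotomicIwasawaMainTheoremIrreducible.lean`, written before the cell's predicate `BigIm` for the
hypothesis (im) existed) — in EXACTLY the vocabulary of the tree's Greenberg–Vatsal / CGS facts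
`GreenbergVatsal2000.thm13_charIdeal_eq_of_gvPar` and
`CastellaGrossiSkinner2025.thmA_charIdeal_eq_padicLFunction` (the same conclusion at an Eisenstein
prime), i.e. the body of the cell's typed input `MazurMainConjecture W p`
(`Summits/…/Theorems/Rank1ResidualX1Defs.lean`), so that the GLUE seat's rank-`0` skeleton
`RowC2.bsdp_rankZero_of_mazurMainConjecture` (`Summits/…/Partition/MainConjectures.lean`) is fed by
a PUBLISHED fact and row C2 ∩ {r = 0} (BCS Cor. 1.3.1) is re-assembled in the kernel from its
printed pieces ("In the case `r = 0`, this follows from the equality of characteristic ideals in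
Theorem 1.1.2, the interpolation property of `L_p(E/ℚ)` at the trivial character, and … the control
theorem [Gre99, Thm. 4.1]", `[corpus: paper:arxiv-2405.00270 p0004 L32–L35]`). Sibling file in this
directory: `PPartBSD.lean` (Cor. 1.3.1 itself, the row's `p`-part fact of record).

## Citation header (read by this seat on the store's text of arXiv:2405.00270v2, `paper:arxiv-2405.00270`, 12 pp.)

* Authors: Ashay Burungale, Francesc Castella, Christopher Skinner.
* Title: *Base change and Iwasawa main conjectures for GL₂*.
* Venue: Int. Math. Res. Not. IMRN **2025**, no. 8, rnaf082, doi:10.1093/imrn/rnaf082 =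
  arXiv:2405.00270v2 (18 Mar 2025) (bib key `BurungaleCastellaSkinner2025`). REFEREED / PUBLISHED
  (Crossref 2025; cell registry row T-BCS; journal pagination cite-only).
* Theorem: **Theorem 1.1.2 (b)** of §1.1 "Cyclotomic Main Conjecture" (`[corpus: p0002 L14–L23]`),
  proved in §5 ("Proof of Theorem 1.1.2", `[p0010 L69 – p0011 L1]`: Lemma 5.2.3 + Prop. 5.2.1 (base
  change from Wan's divisibility over a quartic CM field `M = FK`) + [CGS23, Prop. 1.2.4] +
  [SU14, Props. 3.6, 3.9] + Kato [Kat04, Thm. 17.4]; Lemma 5.2.3 is stated for `p ≥ 5`).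
* Verbatim (p. 2):

> **Theorem 1.1.2.** Let `E` be an elliptic curve defined over `ℚ` and `p` a prime of good
> ordinary reduction for `E`.
> (a) If `p > 3` satisfies (irr_ℚ), then `X^ord(E/ℚ_∞)` is `Λ`-torsion, with
> `ch_Λ(X^ord(E/ℚ_∞)) = (L_p(E/ℚ))` in `Λ ⊗ ℚ_p`.
> (b) If in addition
>   there exists an element `σ ∈ G_{ℚ(μ_{p^∞})}` such that `T/(σ − 1)T ≃ ℤ_p`,   (im)
> then the equality holds in `Λ`, and hence [Mazur's statement 1.1.1] holds.

  with (p. 2, L2–L6) "implicit in [1.1.1] is the integrality statement `L_p(E/ℚ) ∈ Λ` … Let `T` be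
  the `p`-adic Tate module of `E`", "(irr_ℚ): `E[p]` is an irreducible `G_ℚ`-module"; (p. 1,
  L29–L38) "`ℚ_∞` the cyclotomic `ℤ_p`-extension of `ℚ`, `Γ = Gal(ℚ_∞/ℚ)`, `Λ = ℤ_p⟦Γ⟧`",
  "`X^ord(E/ℚ_∞) := Hom_{ℤ_p}(Sel_{p^∞}(E/ℚ_∞), ℚ_p/ℤ_p)`", "`L_p(E/ℚ) ∈ Λ ⊗ ℚ_p` the `p`-adic
  `L`-function attached to `E` by Mazur–Swinnerton-Dyer [MSD74]", statement 1.1.1: "The `Λ`-module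
  `X^ord(E/ℚ_∞)` is torsion, with `ch_Λ(X^ord(E/ℚ_∞)) = (L_p(E/ℚ))` as ideals in `Λ`." Remark 1.1.3:
  "(i) For non-CM curves the condition (im) holds for all sufficiently large primes `p` by Serre's
  open image theorem … (iii) Under the condition (irr_ℚ), the essential case excluded by Theorem
  1.1.2 is that of (residually) dihedral primes `p`."

## Hypotheses, enumerated (word for word → tree predicate; the binder list after the four hypotheses on `(E, p)` is copied VERBATIM from `GreenbergVatsal2000.thm13_charIdeal_eq_of_gvPar` / `CastellaGrossiSkinner2025.thmA_charIdeal_eq_padicLFunction`, whose docstrings justify each atom)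

1. "`E` an elliptic curve defined over `ℚ`" — `W : WeierstrassCurve ℚ`, `[W.IsElliptic]`,
   `[W.IsGloballyMinimal]` (`a_p`, the Néron differential and the conductor read off the minimal
   model). Modularity is a theorem and enters through the newform binder `f`, `IsNewformOf W f`.
2. "`p > 3`", "a prime of good ordinary reduction for `E`" — `3 < p`, `GoodOrd W p`
   (`p ∤ N`, `p ∤ a_p`; `Rank1Residual/Predicates.lean`).
3. (irr_ℚ) — `Irr W p` (`W.HasIrreducibleModPGaloisRep p`).
4. (im) — `BigIm W p` (`Rank1Residual/Predicates.lean`: some `σ ∈ Γ_ℚ` fixing every `p`-power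
   root of unity of `ℚ̄` with `T_pE/(σ − 1)T_pE ≃_{ℤ_p} ℤ_p` on the integral Tate module
   `W.tateModule p`) — the cell's LITERAL transcription of the displayed hypothesis (im); the
   sibling `PPartBSD.lean` (Cor. 1.3.1) uses the same predicate.
5. `ℚ_∞`, `Λ = ℤ_p⟦T⟧`, `T = γ − 1` — `κ : ZpExtension ℚ p` cyclotomic, `γ` a topological generator
   matching the cyclotomic variable of the tree's `p`-adic `L`-function (`IsCyclotomicVariable p γ`),
   `iwasawaToPowerSeries p : Λ → ℚ_p⟦T⟧` — verbatim from the GV / CGS facts and from part (a).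
6. `L_p(E/ℚ)` (Mazur–Swinnerton-Dyer) — the tree's `padicLFunction f (unitRoot W p)`
   (Mazur–Tate–Teitelbaum, normalised by the newform's `Ω⁺_f = plusPeriod f`) re-normalised to the
   model's real period by the rational `ϖ` with `ϖ · Ω_E = Ω⁺_f` (`W.realPeriodRat`), EXACTLY as in
   the GV / CGS facts and in the docstring of part (a) ("normalised by a real period of `E` (the
   Néron period `Ω_E` in Mazur–Tate–Teitelbaum's convention), hence equal to `ϖ · padicLFunction f α`
   for a rational `ϖ ≠ 0`"). `W.realPeriodRat = ∫_{E(ℝ)}|ω_E|` is the Néron period with the number of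
   real components `c_∞ ∈ {1, 2}`, a unit of `ℤ_p` at `p > 3`: the generated ideal of `Λ` is the
   same, and the `∃ g` form below (a generator `g` of the characteristic ideal with
   `ι g = ϖ · L_p(f, α)`) absorbs units. Integrality of `ϖ · L_p(f, α)` (that such a `g ∈ Λ` exists)
   is part of what is printed ("the equality holds in `Λ`, and hence [1.1.1] holds", 1.1.1 including
   "`L_p(E/ℚ) ∈ Λ`"; for irreducible `E[p]` and odd `p` "see [GV00, Prop. 3.1]", p. 2 L5).
7. `X^ord(E/ℚ_∞) = Sel_{p^∞}(E/ℚ_∞)^∨` — every `D : W.SelmerDualData κ γ` (the tree's hypothesis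
   structure for the Pontryagin dual of `lim→ Sel_{p^∞}(E/ℚ_n)`, as in part (a)); conclusion
   `D.IsTorsion ∧ ∃ g, D.charIdeal = (g) ∧ ι g = ϖ · L_p(f, α)`.

No conductor, CM, parity, (ram) or Tamagawa condition (Rem. 1.3.2: "does not impose any condition
on the conductor of `E`"). Relative to part (a) as typed: `hp : 5 ≤ p` there = `3 < p` here; the
newform there is at an arbitrary level `N` with `IsNewformOf W f`, here at `N_E = W.conductorNorm ℤ`
as in `MazurMainConjecture` (Carayol: the level of `f_E` IS `N_E`; nothing lost). No `_holds` is to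
be expected (Wan's `U(3,1)` divisibility, Hida theory over CM fields, Beilinson–Flach classes,
Kato's Euler system: none in Mathlib or the tree); consumers take
`(hB : thm112b_charIdeal_eq_padicLFunction_integral)`. This file introduces exactly ONE named fact
and proves its rank-`0` consumer; nothing else is minted.

## References
* [BurungaleCastellaSkinner2025] A. Burungale, F. Castella, C. Skinner, IMRN 2025 rnaf082 =
  arXiv:2405.00270v2: Thm. 1.1.2 (§1.1, p. 2); statement 1.1.1 and the setting (p. 1); (irr_ℚ),
  (im), Rem. 1.1.3 (p. 2); Cor. 1.3.1 and its proof (§1.3.1, p. 4); §5.2 Lemma 5.2.3 and "Proof of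
  Theorem 1.1.2" (pp. 10–11).
* [GreenbergVatsal2000] R. Greenberg, V. Vatsal, Invent. Math. 142 (2000), Thm. (1.3) — tree fact
  `thm13_charIdeal_eq_of_gvPar`, whose binder list is reused verbatim; §3 (integrality, as cited by BCS p. 2).
* [CastellaGrossiSkinner2025] Theorem A — tree fact `thmA_charIdeal_eq_padicLFunction` (same shape).
* [Greenberg1999] R. Greenberg, LNM 1716 (1999), Thm. 4.1 — the `hGr` input of the rank-`0` glue.
* [SkinnerUrban2014] Thm. 3.6.9 (tree fact bsd.S21 `skinner_urban_main_conjecture`): the same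
  integral equality under (irr) + (ram) + `p`-adic surjectivity, `p ≥ 3` — BCS's Thm. 1.1.2 "removes
  the hypothesis (mult)" (p. 2, L13).
* bsdN/HYPOTHESES.md row T-BCS; RESIDUAL-CASES.md §a.1 C2, §a.2 X9; HOME/CITED-FACTS.md (Cor. 1.3.1
  row; new row for this fact, seat `b2b-bsdres-lit-glue` gen 2).
-/

set_option autoImplicit false

noncomputable section

open scoped Classical MatrixGroups ModularForm

open CongruenceSubgroup WeierstrassCurve Literature.NumberTheory.EllipticCurves
  Literature.NumberTheory.EllipticCurves.ModularForms Literature.NumberTheory.EllipticCurves.Rank1Residual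

namespace Literature.NumberTheory.EllipticCurves.BurungaleCastellaSkinner2025

/-- **Burungale–Castella–Skinner, IMRN 2025 (rnaf082) = arXiv:2405.00270v2, Theorem 1.1.2 (b)
(§1.1, p. 2)**: "Let `E` be an elliptic curve defined over `ℚ` and `p` a prime of good ordinary
reduction for `E`. (a) If `p > 3` satisfies (irr_ℚ), then `X^ord(E/ℚ_∞)` is `Λ`-torsion, with
`ch_Λ(X^ord(E/ℚ_∞)) = (L_p(E/ℚ))` in `Λ ⊗ ℚ_p`. (b) If in addition there exists an element
`σ ∈ G_{ℚ(μ_{p^∞})}` such that `T/(σ − 1)T ≃ ℤ_p` (im), then the equality holds in `Λ`, and hence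
[Mazur's statement 1.1.1: `X^ord(E/ℚ_∞)` is torsion with `ch_Λ(X^ord(E/ℚ_∞)) = (L_p(E/ℚ))` as
ideals in `Λ`, `L_p(E/ℚ) ∈ Λ` included] holds" (the source's word for 1.1.1 elided in this docstring
only because of the tree's docstring lint; what is vendored is the THEOREM (b)). Transcription
(module docstring items 1–7) — the hypotheses on `(E, p)` in the cell's predicates: `3 < p`,
`GoodOrd W p`, `Irr W p` (irr_ℚ), `BigIm W p` (im); everything after them VERBATIM as in
`GreenbergVatsal2000.thm13_charIdeal_eq_of_gvPar` / `CastellaGrossiSkinner2025.thmA_charIdeal_eq_padicLFunction`: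
for the cyclotomic `ℤ_p`-extension `κ`, a topological generator `γ` matching the cyclotomic
variable, the newform `f` of `E` at level `N_E`, the rational `ϖ` with `ϖ · Ω_E = Ω⁺_f` (so that
`ϖ · L_p(f, α)` is the Mazur–Swinnerton-Dyer `p`-adic `L`-function for the model's real period) and
every dual datum `D` (`X^ord(E/ℚ_∞) = Sel_{p^∞}(E/ℚ_∞)^∨`): `D` is `Λ`-torsion and `char_Λ D = (g)`
with `ι g = ϖ · L_p(f, α)`, `α = unitRoot W p` — the body of the cell's typed (MC) input predicate
of `Summits/…/Theorems/Rank1ResidualX1Defs.lean` and the spelling of the hypothesis `hMC` of the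
tree's rank-`0` glue theorem of `LeadingTermPPartEisensteinProofs` (the one consumed by
`GreenbergVatsal2000.pPartRankZero_of_gvPar`). Part (a) is the tree fact
`burungale_castella_skinner_charIdeal_eq_padicLFunction` (rational, `∃ g k, … ι g = p^k · L_p(f, α)`).
PUBLISHED (census row T-BCS, class C2).
[cite: BurungaleCastellaSkinner2025, Thm. 1.1.2 (b) (§1.1, p. 2 of arXiv:2405.00270v2), with statement 1.1.1 (p. 1) and (irr_Q), (im) (p. 2)]
[cite: GreenbergVatsal2000, Thm. (1.3) (binder list of the tree transcription reused verbatim)] -/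
def thm112b_charIdeal_eq_padicLFunction_integral : Prop :=
  ∀ (W : WeierstrassCurve ℚ) [W.IsElliptic] [W.IsGloballyMinimal] (p : ℕ) [Fact p.Prime],
    3 < p → GoodOrd W p → Irr W p → BigIm W p →
    ∀ (κ : ZpExtension ℚ p) (γ : Field.absoluteGaloisGroup ℚ),
        κ.IsCyclotomic → κ.IsTopGenerator γ → IsCyclotomicVariable p γ →
      ∀ [NeZero (W.conductorNorm ℤ)] (f : CuspForm (Gamma0 (W.conductorNorm ℤ)) 2),
        IsNewformOf W f → ∀ (ϖ : ℚ), (ϖ : ℝ) * W.realPeriodRat = plusPeriod f →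
      ∀ (D : W.SelmerDualData κ γ), D.IsTorsion ∧
        ∃ g : IwasawaAlgebra p, D.charIdeal = Ideal.span {g} ∧
          iwasawaToPowerSeries p g =
            PowerSeries.C (ϖ : ℚ_[p]) * padicLFunction f (unitRoot W p : ℚ_[p])

/-- **Theorem 1.1.2 (b) ⇒ the rank-`0` print shape** (the `r = 0` half of BCS Cor. 1.3.1,
re-assembled in the kernel from its printed pieces — "In the case `r = 0`, this follows from the
equality of characteristic ideals in Theorem 1.1.2, the interpolation property of `L_p(E/ℚ)` at the
trivial character, and the formula (up to a `p`-adic unit) in the control theorem [Gre99, Thm. 4.1]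
for the value of a characteristic power series for `X^ord(E/ℚ_∞)` at the trivial character",
p. 4): for `W/ℚ` globally minimal elliptic, `p > 3` good ordinary with `E[p]` irreducible and (im),
and `L(E,1) ≠ 0`, the rank-`0` shape `PPartRankZero W p`
(`ord_p(L(E,1)/Ω_E) = ord_p #Ш + ord_p ∏c_ℓ − 2 ord_p #E(ℚ)_tors`) follows from Theorem 1.1.2 (b)
(`hB`), Greenberg's Thm. 4.1 (`hGr`, inline exactly as in `GreenbergVatsal2000.pPartRankZero_of_gvPar`
and `CastellaGrossiSkinner2025.pPartRankZero_of_thmA`), modularity with integral Manin constant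
(`hmod`) and Gross–Zagier–Kolyvagin (`hGZK`, finiteness of `Ш`), through the tree glue
`padicValRat_bsd_rank_zero_of_mazurMainConjecture`. The non-CM hypothesis of Cor. 1.3.1 is not
needed for this half. [cite: BurungaleCastellaSkinner2025, Cor. 1.3.1 (r = 0) and its proof (§1.3.1 p. 4), from Thm. 1.1.2 (b)]
[cite: GreenbergLNM1716, Thm. 4.1 (the shape of `hGr`)] -/
theorem pPartRankZero_of_thm112b (hB : thm112b_charIdeal_eq_padicLFunction_integral)
    (hmod : nonempty_modularParametrizationData)
    (hGZK : rank_eq_analyticRank_of_analyticRank_le_one)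
    (W : WeierstrassCurve ℚ) [W.IsElliptic] [W.IsGloballyMinimal] (p : ℕ) [Fact p.Prime]
    (hp : 3 < p) (hord : GoodOrd W p) (hirr : Irr W p) (him : BigIm W p)
    (hL : W.entireLFunction 1 ≠ 0)
    (hGr : ∀ (κ : ZpExtension ℚ p) (γ : Field.absoluteGaloisGroup ℚ),
        κ.IsCyclotomic → κ.IsTopGenerator γ → IsCyclotomicVariable p γ →
      ∀ (D : W.SelmerDualData κ γ) [Module.Finite (IwasawaAlgebra p) D.X], D.IsTorsion →
      ∀ (fE : IwasawaAlgebra p), D.charIdeal = Ideal.span {fE} →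
        Finite (W.selmerGroupPInfty p) →
        ∃ u : ℤ_[p]ˣ,
          ((PowerSeries.constantCoeff fE : ℤ_[p]) : ℚ_[p]) *
              (Nat.card (AddCommGroup.primaryComponent W.toAffine.Point p) : ℚ_[p]) ^ 2 =
            ((u : ℤ_[p]) : ℚ_[p]) * (p : ℚ_[p]) ^ (padicValNat p W.tamagawaProduct) *
              (Nat.card (AddCommGroup.primaryComponent
                ((integralModelInt W).map (Int.castRingHom (ZMod p))).toAffine.Point p) : ℚ_[p]) ^ 2 *
              (Nat.card (W.selmerGroupPInfty p) : ℚ_[p])) :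
    PPartRankZero W p := by
  have hr : W.analyticRank = 0 :=
    Literature.NumberTheory.EllipticCurves.analyticRank_eq_zero_of_entireLFunction_one_ne_zero W hL
  obtain ⟨-, hfin⟩ := hGZK W (by omega)
  exact padicValRat_bsd_rank_zero_of_mazurMainConjecture W p hord.1 hord.2 hL hfin hmod hGr
    (hB W p hp hord hirr him)

end Literature.NumberTheory.EllipticCurves.BurungaleCastellaSkinner2025

end
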